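import Summits.BirchSwinnertonDyer.BirchSwinnertonDyer.Theses.PrintCf2
import Literature.NumberTheory.EllipticCurves.AnalyticRankModularityProofs
import Literature.NumberTheory.EllipticCurves.CongruentNumberEvenMonskySelmerExact
import Literature.NumberTheory.QuadraticFields.RedeiReichardtFourRank
import HarnessLib

/-!
# Route `PrintCf2`, support item `PublishedFactsCf2` (stmt-BirchSwinnertonDyer-20369): the SLIMMED
# dependency list — the sixteen-conjunct congruent-number print pack from FOURTEEN inputs

D-0154 (2) INPUTS→UNCONDITIONAL, `INPUTS-LIST-2.md` §4 T1 «PackSlim» (cell `pub/bsd-wall`, seat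
`bsd-inputs-pack-p1`). `PublishedFactsCf2` is the conjunction of sixteen published named facts:
Li–Tian–Yan–Zhu 2025 Thm 1.1 (`LTYZThm11CMRankOnePPart`, 19141), GZK (`RankEqAnalyticRankLeOne`, 19921),
entireness of `L(E,s)` (`EntireLFunctionRat`, 19273), isogeny invariance of the BSD quotient
(`BSDQuotientIsogenyInvariance`, 19307), the CM rank-0 triple (`CMRankZeroBSDTriple`, 19423),
Tian–Yuan–Zhang 2017 Thm 1.2′ (`TYZParityOfScriptLPrime`, 20584), Tian 2014 Thm 1.3
(`TianRankOneShaOdd`, 20585), Rédei–Reichardt (`QuadraticFields.RedeiReichardt.redeiReichardt_fourTwoCard_classGroup`),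
Li–Liu–Tian 2024 Thm 1.2 (`LLTCongruentNumberBSD`, 20586), Monsky 1990 Cor 5.15
(`MonskyCor515RankOneSelmer`, 20587), Heath-Brown 1994 / Monsky even 2-Selmer formula
(`HBMonskySelmerEven`, 20588), Tian's `𝒮⁻` genus system (`TianSMinusGenusSystem`, 20589), Kriz–Li 2019
Thm 1.12 (`KrizLiThm112Twist`, 20590), Shu–Zhai 2021 Thm 1.2 / 1.4 / 4.10 (`ShuZhaiThm12Ranks` 20591,
`ShuZhaiThm14TwoPartBSD` 20592, `ShuZhaiThm410Valuations` 20593). THREE conjuncts are THEOREMS of the tree: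

* conjunct 8, Rédei–Reichardt (four-rank of the class group from the Rédei matrix):
  `QuadraticFields.RedeiReichardt.redeiReichardt_fourTwoCard_classGroup_holds`
  (`Literature/NumberTheory/QuadraticFields/RedeiReichardtFourRank.lean`);
* conjunct 11, Monsky's even-case 2-Selmer formula (the route's CLOSED item 20588):
  `HeathBrown1994.monsky_card_selmerGroup_two_even_holds`
  (`Literature/NumberTheory/EllipticCurves/CongruentNumberEvenMonskySelmerExact.lean`);
* conjunct 3, entireness, given the Modularity Theorem displayed on the same route as
  `ModularityExistsNewform` (19382): `WeierstrassCurve.hasEntireLFunction_rat_of_exists_isNewformOf`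
  (`AnalyticRankModularityProofs.lean`).

Theorems: `publishedFactsCf2_of_slim` — the pack from FOURTEEN registered children (all but Rédei and
HB–Monsky even; 16 → 14); `publishedFactsCf2_of_slim_newform` — the same with `EntireLFunctionRat`
replaced by `ModularityExistsNewform` (the route's modularity display unified); the in-route edge
`printCf2_entireLFunctionRat_of_modularityExistsNewform`. HONEST FRAMING: pure glue over landed theorems; no cite-only fact is proved here; the fourteen
remaining inputs stay print hypotheses and the route stays conditional on them AS TYPED. Nothing here
proves BSD; BSD is not proved by any of this.
-/

set_option autoImplicit false
set_option linter.dupNamespace false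

namespace Summit.BirchSwinnertonDyer.BirchSwinnertonDyer.Theorems

open Literature.NumberTheory.EllipticCurves
open Summit.BirchSwinnertonDyer.BirchSwinnertonDyer.Theses.PrintCf2

/-- In-route edge (route `PrintCf2`): the Modularity Theorem `ModularityExistsNewform` (19382) gives
`EntireLFunctionRat` (19273), by `WeierstrassCurve.hasEntireLFunction_rat_of_exists_isNewformOf`.
[folklore] -/
theorem printCf2_entireLFunctionRat_of_modularityExistsNewform (hnf : ModularityExistsNewform) :
    Summit.BirchSwinnertonDyer.BirchSwinnertonDyer.Theses.PrintCf2.EntireLFunctionRat :=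
  WeierstrassCurve.hasEntireLFunction_rat_of_exists_isNewformOf hnf

/-- **`PublishedFactsCf2` from fourteen of its sixteen children, BY NAME** (route `PrintCf2`, item
stmt-BirchSwinnertonDyer-20369; INPUTS-LIST-2 T1): conjunct 8 (Rédei–Reichardt) is the tree theorem
`QuadraticFields.RedeiReichardt.redeiReichardt_fourTwoCard_classGroup_holds` and conjunct 11
(Heath-Brown 1994 / Monsky even-case 2-Selmer formula, CLOSED item 20588) is
`HeathBrown1994.monsky_card_selmerGroup_two_even_holds`; the other fourteen children are hypotheses.
Pure glue; the fourteen hypotheses remain print inputs. [folklore] -/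
theorem publishedFactsCf2_of_slim
    (hLTYZ : LTYZThm11CMRankOnePPart) (hGZK : RankEqAnalyticRankLeOne) (hEnt : EntireLFunctionRat)
    (hIsog : BSDQuotientIsogenyInvariance) (hCM : CMRankZeroBSDTriple) (hTYZ : TYZParityOfScriptLPrime)
    (hT13 : TianRankOneShaOdd) (hLLT : LLTCongruentNumberBSD) (hM515 : MonskyCor515RankOneSelmer)
    (hSMinus : TianSMinusGenusSystem) (hKL : KrizLiThm112Twist) (hSZ12 : ShuZhaiThm12Ranks)
    (hSZ14 : ShuZhaiThm14TwoPartBSD) (hSZ410 : ShuZhaiThm410Valuations) :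
    Summit.BirchSwinnertonDyer.BirchSwinnertonDyer.Theses.PrintCf2.PublishedFactsCf2 :=
  ⟨hLTYZ, hGZK, hEnt, hIsog, hCM, hTYZ, hT13,
    Literature.NumberTheory.QuadraticFields.RedeiReichardt.redeiReichardt_fourTwoCard_classGroup_holds,
    hLLT, hM515, HeathBrown1994.monsky_card_selmerGroup_two_even_holds, hSMinus, hKL, hSZ12, hSZ14,
    hSZ410⟩

/-- **`PublishedFactsCf2` with the route's modularity display unified**: as `publishedFactsCf2_of_slim`
but with the entire continuation `EntireLFunctionRat` (19273) supplied from the Modularity Theorem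
`ModularityExistsNewform` (19382, displayed by this route) via
`printCf2_entireLFunctionRat_of_modularityExistsNewform`. Pure glue; fourteen registered hypotheses.
[folklore] -/
theorem publishedFactsCf2_of_slim_newform
    (hLTYZ : LTYZThm11CMRankOnePPart) (hGZK : RankEqAnalyticRankLeOne) (hnf : ModularityExistsNewform)
    (hIsog : BSDQuotientIsogenyInvariance) (hCM : CMRankZeroBSDTriple) (hTYZ : TYZParityOfScriptLPrime)
    (hT13 : TianRankOneShaOdd) (hLLT : LLTCongruentNumberBSD) (hM515 : MonskyCor515RankOneSelmer)
    (hSMinus : TianSMinusGenusSystem) (hKL : KrizLiThm112Twist) (hSZ12 : ShuZhaiThm12Ranks)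
    (hSZ14 : ShuZhaiThm14TwoPartBSD) (hSZ410 : ShuZhaiThm410Valuations) :
    Summit.BirchSwinnertonDyer.BirchSwinnertonDyer.Theses.PrintCf2.PublishedFactsCf2 :=
  publishedFactsCf2_of_slim hLTYZ hGZK (printCf2_entireLFunctionRat_of_modularityExistsNewform hnf)
    hIsog hCM hTYZ hT13 hLLT hM515 hSMinus hKL hSZ12 hSZ14 hSZ410

end Summit.BirchSwinnertonDyer.BirchSwinnertonDyer.Theorems
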